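import Summits.HodgeConjecture.HodgeConjecture.Theorems.DworkReflectionQuotientsGIOfAnalyticInputs
import Literature.AlgebraicGeometry.HodgeTheory.DworkSexticPencilHodgeLoci
import Summits.HodgeConjecture.HodgeConjecture.Theorems.DworkReflectionQuotientsHodgeOfInvariantPart
import Summits.HodgeConjecture.HodgeConjecture.Theorems.DworkReflectionQuotientsDworkOtherCodimensions

/-!
# Route `DworkReflectionQuotients`: crux `GenericInvariantHodgeClasses` (GI) modulo the two named analytic
# facts of the Dwork pencil

Route `route-HodgeConjecture-DworkReflectionQuotients` (cell `hodge-nonav`; FRONTIER rung F-H1 — never summit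
credit), item `stmt-HodgeConjecture-24129` `GenericInvariantHodgeClasses`. Prover seat `hodge-nonav-20241-p1`
(g9). SUPPORT FILE (`--supports`; CONDITIONAL result): the item's signature verbatim from the two Literature
named facts `DworkSextic.Voisin2002_dworkPencil_hodgeFiltrationTwo_locus_dichotomy` (holomorphy of `F²𝓗⁴`
along the pencil, read on the curve `D(ℂ)`: Voisin I Thm. 10.3 / II Lemma 5.13) and
`DworkSextic.Voisin2003_dworkPencil_invariantFlatSection_climb` (the Carlson–Griffiths–Voisin infinitesimal
Noether–Lefschetz step on the `Γ_W`-invariant piece: Voisin II Cor. 6.12, Thm. 6.13, Cor. 5.17, whose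
Jacobian-ring input is the tree theorem `DworkSextic.prod_X_mul_mem_jacobianIdeal_iff`), by the
unconditional `genericInvariantHodgeClasses_of_hol_of_climb` (file `DworkReflectionQuotientsGIOfAnalyticInputs`).
When the route file acquires the decl `GenericInvariantHodgeClasses`, a one-line theorem concluding it by name
is `genericInvariantHodgeClasses_of_facts` (the signature is literally the item's). COROLLARIES (composition
with the g8 glue `genericHodgeClassesFlat_of_reflectionQuotientDescent_of_genericInvariant`,
`dworkSexticHodge_of_reflectionQuotientDescent_of_genericInvariant` and the proved `DworkOtherCodimensions`):
the support `GenericHodgeClassesFlat` (stmt-HodgeConjecture-20243) and the rung leaf `DworkSexticHodge` BY NAME,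
from crux K1 `ReflectionQuotientDescent` (open; itself in tree modulo the Bini–Garbagnati fact) and the two
analytic facts — i.e. the route's residual print dependence is now exactly
{Bini–Garbagnati 3.20 + KMM, Voisin I 10.3 along the pencil, Voisin II 6.13 along the pencil}. Nothing here
says HC, HC_CM or HC_AV is proved; rung F-H1 not moved.

## References

* C. Voisin, *Hodge Theory and Complex Algebraic Geometry II* (2003), §5.3, §6.1, Thm. 6.24 (proof).
  [VoisinHodgeII2003]
* C. Voisin, *Hodge Theory and Complex Algebraic Geometry I* (2002), Thm. 10.3. [VoisinHodgeI2002]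
-/

namespace Summit.HodgeConjecture.HodgeConjecture.Theorems

open Literature.AlgebraicGeometry.HodgeTheory

/-- **`GenericInvariantHodgeClasses` (stmt-HodgeConjecture-24129) from the two named analytic facts**
`Voisin2002_dworkPencil_hodgeFiltrationTwo_locus_dichotomy` (holomorphy of `F²𝓗⁴` along the pencil, on the
curve `D(ℂ)`) and `Voisin2003_dworkPencil_invariantFlatSection_climb` (Carlson–Griffiths–Voisin IVHS step on
the `Γ_W`-invariant piece, whose Jacobian-ring input is proved in the tree): the item's signature verbatim,
by `genericInvariantHodgeClasses_of_hol_of_climb`. CONDITIONAL result; rung F-H1 not moved.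
[cite: VoisinHodgeII2003, Thm. 6.24 (proof)] [cite: VoisinHodgeI2002, Thm. 10.3] -/
theorem genericInvariantHodgeClasses_of_facts
    (hhol : DworkSextic.Voisin2002_dworkPencil_hodgeFiltrationTwo_locus_dichotomy)
    (hclimb : DworkSextic.Voisin2003_dworkPencil_invariantFlatSection_climb) :
    ∃ S : Set ℂ, S.Countable ∧ ∀ ψ : ℂ, ψ ∉ S → ψ ^ 6 ≠ 1 → let F : MvPolynomial (Fin 6) ℂ := (∑ i, MvPolynomial.X i ^ 6) - MvPolynomial.C (6 * ψ) * ∏ i, MvPolynomial.X i; let X := Literature.AlgebraicGeometry.Motives.SmoothHypersurface.hypersurface F; let pt := Literature.AlgebraicGeometry.HodgeTheory.hypersurfacePoint (Literature.AlgebraicGeometry.Motives.SmoothHypersurface.hypersurfaceι F); ∀ c : Literature.AlgebraicGeometry.HodgeTheory.complexBetti X (2 * 2), Literature.AlgebraicGeometry.HodgeTheory.IsRationalClass c → Literature.AlgebraicGeometry.HodgeTheory.IsOfHodgeType 4 X (2 * 2) 2 2 c → (∀ a : Fin 6 → ℂ, (∀ i, a i ^ 6 = 1) → ∏ i, a i =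 1 → ∀ g : C(Literature.AlgebraicGeometry.Motives.ComplexPoints X, Literature.AlgebraicGeometry.Motives.ComplexPoints X), (∀ x, ∃ t : ℂ, (pt (g x)).rep = t • (a * (pt x).rep)) → Literature.AlgebraicTopology.SingularHomology.singularCohomology.map ℂ ℂ g (2 * 2) c = c) → c ∈ Literature.AlgebraicGeometry.HodgeTheory.algebraicClasses X 2 :=
  genericInvariantHodgeClasses_of_hol_of_climb hhol hclimb

/-- **The support `GenericHodgeClassesFlat` (stmt-HodgeConjecture-20243) BY NAME, from crux K1 and the two
analytic facts** (g8 glue `genericHodgeClassesFlat_of_reflectionQuotientDescent_of_genericInvariant` composed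
with `genericInvariantHodgeClasses_of_facts`). CONDITIONAL (K1 open; two named facts); rung F-H1 not moved.
[cite: VoisinHodgeII2003, Thm. 6.24 (proof)] [cite: Katz2009, §3] -/
theorem genericHodgeClassesFlat_of_reflectionQuotientDescent_of_facts
    (h1 : Summit.HodgeConjecture.HodgeConjecture.Theses.DworkReflectionQuotients.ReflectionQuotientDescent)
    (hhol : DworkSextic.Voisin2002_dworkPencil_hodgeFiltrationTwo_locus_dichotomy)
    (hclimb : DworkSextic.Voisin2003_dworkPencil_invariantFlatSection_climb) :
    Summit.HodgeConjecture.HodgeConjecture.Theses.DworkReflectionQuotients.GenericHodgeClassesFlat :=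
  genericHodgeClassesFlat_of_reflectionQuotientDescent_of_genericInvariant h1
    (genericInvariantHodgeClasses_of_facts hhol hclimb)

/-- **The rung leaf `DworkSexticHodge` (HC for the very general Dwork sextic fourfold) BY NAME, from crux K1
and the two analytic facts** (`DworkOtherCodimensions` is the tree theorem `dworkOtherCodimensions_proof`;
g8 glue `dworkSexticHodge_of_reflectionQuotientDescent_of_genericInvariant`). CONDITIONAL (K1
`ReflectionQuotientDescent` open — in tree modulo `DworkSextic.BiniGarbagnati2012_reflectionQuotient_smoothProjective_rcc`;
two named analytic facts); FRONTIER rung F-H1, never summit credit; nothing here says HC, HC_CM or HC_AV is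
proved. [cite: VoisinHodgeII2003, Thm. 6.24 (proof)] [cite: Katz2009, §3] -/
theorem dworkSexticHodge_of_reflectionQuotientDescent_of_facts
    (h1 : Summit.HodgeConjecture.HodgeConjecture.Theses.DworkReflectionQuotients.ReflectionQuotientDescent)
    (hhol : DworkSextic.Voisin2002_dworkPencil_hodgeFiltrationTwo_locus_dichotomy)
    (hclimb : DworkSextic.Voisin2003_dworkPencil_invariantFlatSection_climb) :
    Summit.HodgeConjecture.HodgeConjecture.Theses.DworkPrymHodge.DworkSexticHodge :=
  dworkSexticHodge_of_reflectionQuotientDescent_of_genericInvariant h1 dworkOtherCodimensions_proof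
    (genericInvariantHodgeClasses_of_facts hhol hclimb)

end Summit.HodgeConjecture.HodgeConjecture.Theorems
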